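import Literature.Computability.Complexity.IKWSimulationMachine
import Literature.Computability.Complexity.MurrayWilliams2018EasyWitness
import Literature.Computability.Complexity.MurrayWilliams2018AlmostAE
import Literature.Computability.Complexity.MurrayWilliams2018StringComplexity
import HarnessLib

/-!
# Murray–Williams 2018, Lemma 4.1 (proof): the derandomized simulation `N` — behaviour and
# correctness on the good input lengths

Part of the formalization of the PROOF of the Easy Witness Lemma for low nondeterministic time
(C. D. Murray, R. R. Williams, *Circuit lower bounds for nondeterministic quasi-polytime: an easy
witness lemma for NP and NQP*, STOC 2018 / ECCC TR17-188, Lemma 4.1, pp. 13–14; named fact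
`MurrayWilliams2018_lemma_4_1_ae`, `MurrayWilliams2018EasyWitness.lean`) from its two quoted
ingredients — the Merlin–Arthur lower bound with advice (Thm. 3.1) and Umans' generator (Thm. 2.1).
The printed proof derandomizes the Merlin–Arthur protocol `M₁` of Thm. 3.1 by a nondeterministic
algorithm `N` (p. 14): "On inputs `x` of length `nᵢ` … `N` first guesses a string `y_hard` of length
`O(t(nᵢ))` and runs `V(x_hard, y_hard)`. If `V` rejects, then `N` rejects. Otherwise, `N` will use
`y_hard` as a hard function in the pseudorandom generator `G(·,·)` … `N` nondeterministically
guesses an input `z`, and enumerates all `s = |y_hard|^g` seeds to the generator `G(y_hard, ·)` …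
computes the probability that `C_x(y_hard, r_j)` accepts over all `j = 1, …, s`. If this probability
is greater than `1/2`, then `N` accepts else it rejects", the advice `(x_hard, αₙ)` being folded into
the input. This file fixes the input/output BEHAVIOUR of `N` as a Boolean function (`verdictBit`,
on the pattern of `IKWSim.verdictBit` of `IKWSimulationMachine.lean`, the tree's proof of the same
Goldreich–Zuckerman simulation for IKW's Thm. 12) over

* an arbitrary verifier `V : NVerifier t L` (the verifier without witness circuits),
* an arbitrary predicate `Ref` of Arthur in a two-move Merlin–Arthur game with advice, read on the
  nested pair words `⟨⟨⟨x, α⟩, z⟩, r⟩` (input, advice, Merlin's message, Arthur's coins; the promise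
  of Def. 2.1 of the source is stated on `Pr_r[⟨⟨⟨x, α⟩, z⟩, r⟩ ∈ Ref]`, `|z| = |r| = mv |x|` —
  the value of the game `[merlin, arthur]` of `MAPromiseAdvice`, `MerlinArthurAdvice.lean`, by
  `amValue_merlin_arthur`, up to the coding of the moves), move length `mv |x|`,
* an arbitrary string function `F` read as the generator `G_T(σ) = F ⟨T, ⟨1^{nb}, σ⟩⟩ ↾ nb`
  (`tableGenerator`, `HardnessVsRandomness.lean`) with seeds of length `γ · M` at table scale `M`
  (Umans: seed length `g log |Y|`), output length `nb = Nb |x| |α|`,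

and PROVES its correctness on the inputs `⟨x, ⟨x_hard, α⟩⟩` for which `x_hard` is a bad input of
`V` at a hardness level `H` feeding the generator (`verdictBit_eq_false`, `verdictBit_eq_true`,
`mem_simLang_iff`): there `N` decides exactly the language of the promise of the game. The words
are `w = ⟨x, ⟨x_h, α⟩⟩`, the witnesses `u = ⟨y', z'⟩` cut at a kept length `U |w|`; the table is
the accepted witness `y = y' ↾ (c_V t |x_h| + c_V)` padded by `0`s to the length `2^M`,
`M = ⌊log₂ (c_V t |x_h| + c_V)⌋ + 1` (`tableOf`; any table with an accepted witness of a bad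
input as a prefix is hard — this is how "`CC(y_hard) ≥ w`" is used), Merlin's message is
`z = z' ↾ mv |x|` padded, and the verdict is `V.rel x_h y ∧ [2^{γM} < 2 · #accepting seeds]`.

Also proved here: the **advice-folding** estimate `circuitSize_preimage_boolPair_le` — a circuit
for the slice of a language of pair words `⟨x, β⟩` at length `2ℓ + |β| + 2` gives, with `β`
hard-wired (two extra constant gates, `Circuit.exists_hardwire`), a circuit for
`{x : ⟨x, β⟩ ∈ L'}` at length `ℓ` ("the nondeterministic `O(t(n)ᵉ)`-time algorithm `N` (using
`(2d+1)n` bits of advice) … has circuits of size `s((2d+2)n)`", p. 14).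

The running time of `N` (a `TM2` verifier placing `simLang` in `NTIME (t · ^ e)`) and the
assembly of Lemma 4.1 are in the sequel files. Definitions with bodies and theorems only; no named
fact is introduced.

## References

* C. D. Murray, R. R. Williams, *Circuit lower bounds for nondeterministic quasi-polytime: an easy
  witness lemma for NP and NQP*, STOC 2018 (ECCC TR17-188), proof of Lemma 4.1, pp. 13–14
  [MurrayWilliams2018].
* R. Impagliazzo, V. Kabanets, A. Wigderson, *In search of an easy witness*, JCSS 65 (2002), §2.4,
  Thm. 12 (the simulation pattern) [ImpagliazzoKabanetsWigderson2002].
* S. Arora, B. Barak, *Computational Complexity: A Modern Approach*, CUP 2009, proof of Lemma 20.3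
  (enumerate all seeds, majority vote) [AroraBarakCC2009].
-/

noncomputable section

namespace Literature.Computability.Complexity

open _root_.Computability Finset Filter AMPlayer MetaComplexity Brick

namespace MWSim

section Defs

variable (t : ℕ → ℕ) {L : Language Bool} (V : NVerifier t L) (Ref : Language Bool)
  (F : List Bool → List Bool) (γ : ℕ) (mv : ℕ → ℕ) (Nb : ℕ → ℕ → ℕ) (U : ℕ → ℕ)

/-- The admissible witness length of `V` at input length `n`: `c_V · t n + c_V`. [folklore] -/
def bound (n : ℕ) : ℕ := V.c * t n + V.c

/-- **The table scale** at length `n` of the hard input: `M = ⌊log₂ (c_V t n + c_V)⌋ + 1`, so that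
`c_V t n + c_V < 2^M ≤ 2 (c_V t n + c_V)` — every admissible witness fits in a table of `2^M` bits.
[cite: MurrayWilliams2018, Lemma 4.1 (proof)] -/
def scale (n : ℕ) : ℕ := Nat.log 2 (bound t V n) + 1

/-- The witness of `V` read off the first component of the (kept) guess: cut to the admissible
length. [cite: MurrayWilliams2018, Lemma 4.1 (proof)] -/
def witOf (xh y' : List Bool) : List Bool := y'.take (bound t V xh.length)

/-- **The table**: the witness padded by `0`s to `2^M` bits ("use `y_hard` as a hard function").
[cite: MurrayWilliams2018, Lemma 4.1 (proof)] -/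
def tableOf (xh y' : List Bool) : List Bool :=
  List.takeD (2 ^ scale t V xh.length) (witOf t V xh y') false

/-- **The number of accepting seeds**: the number of `i < 2^k` whose seed `ρᵢ = takeD k (bin i)`
makes Arthur accept `⟨⟨⟨x, α⟩, z⟩, G_T(ρᵢ) ↾ m⟩`. [cite: MurrayWilliams2018, Lemma 4.1 (proof)] -/
def accCount (x α z T : List Bool) (k nb m : ℕ) : ℕ :=
  ∑ i ∈ Finset.range (2 ^ k),
    (Ref.boolIndicator (boolPair (boolPair (boolPair x α) z) (List.takeD m
      (F (boolPair T (boolPair (unaryEncodeNat nb) (List.takeD k (encodeNat i) false)))) false))).toNat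

/-- **The behaviour of the simulation `N`** on the word `w = ⟨x, ⟨x_h, α⟩⟩` and the guess `u`:
keep `u ↾ U|w| = ⟨y', z'⟩`; the witness `y = y' ↾ (c_V t|x_h| + c_V)`, the table `T = y 0⋯0`
(`2^M` bits), Merlin's message `z = z' ↾ mv|x|` (padded); reject unless `V(x_h, y)` accepts;
accept iff a majority of the `2^{γM}` seeds make Arthur accept.
[cite: MurrayWilliams2018, Lemma 4.1 (proof)] -/
def verdictBit (w u : List Bool) : Bool :=
  V.rel (fstF (sndF w)) (witOf t V (fstF (sndF w)) (fstF (u.take (U w.length)))) &&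
    decide (2 ^ (γ * scale t V (fstF (sndF w)).length) <
      2 * accCount Ref F (fstF w) (sndF (sndF w))
        (List.takeD (mv (fstF w).length) (sndF (u.take (U w.length))) false)
        (tableOf t V (fstF (sndF w)) (fstF (u.take (U w.length))))
        (γ * scale t V (fstF (sndF w)).length)
        (Nb (fstF w).length (sndF (sndF w)).length) (mv (fstF w).length))

/-- **The simulation language**: words having a guess of length `≤ U |w|` accepted by `N`.
[cite: MurrayWilliams2018, Lemma 4.1 (proof)] -/
def simLang : Language Bool :=
  {w | ∃ u : List Bool, u.length ≤ U w.length ∧ verdictBit t V Ref F γ mv Nb U w u = true}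

end Defs

/-! ### Elementary properties of the scale and the table -/

/-- `takeD` beyond the length pads with the default (cf. `PRGDerand.takeD_encodeNat_eq_natBits`).
[folklore] -/
theorem takeD_of_length_le {n : ℕ} {l : List Bool} {d : Bool} (h : l.length ≤ n) :
    List.takeD n l d = l ++ List.replicate (n - l.length) d := by
  induction l generalizing n with
  | nil => rw [List.takeD_nil]; simp
  | cons b l ih =>
    cases n with
    | zero => simp at h
    | succ n =>
      rw [List.takeD_succ, List.length_cons, Nat.add_sub_add_right, List.head?_cons, Option.getD_some,
        List.tail_cons, ih (by simpa using h), List.cons_append]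

section Basic

variable {t : ℕ → ℕ} {L : Language Bool} (V : NVerifier t L)

/-- The admissible length is below `2^M`. [folklore] -/
theorem bound_lt_two_pow_scale (n : ℕ) : bound t V n < 2 ^ scale t V n :=
  Nat.lt_pow_succ_log_self one_lt_two _

/-- `2^M ≤ 2 (c_V t n + c_V) + 2`. [folklore] -/
theorem two_pow_scale_le (n : ℕ) : 2 ^ scale t V n ≤ 2 * bound t V n + 2 := by
  unfold scale
  rw [pow_succ]
  have := Nat.pow_log_le_add_one 2 (bound t V n)
  omega

/-- The witness read off the guess is admissible. [folklore] -/
theorem length_witOf_le (xh y' : List Bool) : (witOf t V xh y').length ≤ bound t V xh.length :=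
  List.length_take_le _ _

/-- The table has `2^M` bits. [folklore] -/
@[simp] theorem length_tableOf (xh y' : List Bool) :
    (tableOf t V xh y').length = 2 ^ scale t V xh.length :=
  List.takeD_length _ _ _

/-- The table is the witness padded by `0`s. [folklore] -/
theorem tableOf_eq (xh y' : List Bool) :
    tableOf t V xh y' = witOf t V xh y' ++
      List.replicate (2 ^ scale t V xh.length - (witOf t V xh y').length) false := by
  unfold tableOf
  exact takeD_of_length_le ((length_witOf_le V xh y').trans (bound_lt_two_pow_scale V _).le)

/-- The witness is a prefix of the table. [folklore] -/
theorem witOf_prefix_tableOf (xh y' : List Bool) : witOf t V xh y' <+: tableOf t V xh y' := by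
  rw [tableOf_eq]; exact List.prefix_append _ _

end Basic

/-! ### Counting the accepting seeds -/

section Correct

variable {t : ℕ → ℕ} {L : Language Bool} (V : NVerifier t L) (Ref : Language Bool)
  (F : List Bool → List Bool) (γ : ℕ) (mv : ℕ → ℕ) (Nb : ℕ → ℕ → ℕ) (U : ℕ → ℕ)

/-- **The pseudorandom acceptance count**: for Arthur's circuit `C` at `(x, α, z)` (value
`[⟨⟨⟨x, α⟩, z⟩, r↾m⟩ ∈ Ref]`) and the generator `G_f` of the table `T = truthTable f`, the seeds
`s ∈ {0,1}^k` with `C(G_f(s)) = 1` are counted by `accCount`.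
[cite: AroraBarakCC2009, Lemma 20.3 (proof)] -/
theorem card_seeds_eq_accCount (x α z : List Bool) {M : ℕ} (f : (Fin M → Bool) → Bool)
    {nb m k : ℕ} (hm : m ≤ nb) (C : Circuit (Fin nb))
    (hC : ∀ r, C.eval r = Ref.boolIndicator
      (boolPair (boolPair (boolPair x α) z) (List.ofFn fun i : Fin m => r (Fin.castLE hm i)))) :
    #{s : Fin k → Bool | C.eval (tableGenerator F f k nb s) = true} =
      accCount Ref F x α z (truthTable f) k nb m := by
  classical
  set E : Set (List Bool) := {σ | boolPair (boolPair (boolPair x α) z) (List.takeD m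
    (F (boolPair (truthTable f) (boolPair (unaryEncodeNat nb) σ))) false) ∈ Ref} with hE
  have h1 : accCount Ref F x α z (truthTable f) k nb m = cnt k E := by
    rw [accCount, ← CoinEnum.sum_range_ite_natBits]
    refine Finset.sum_congr rfl fun i hi => ?_
    rw [PRGDerand.takeD_encodeNat_eq_natBits (Finset.mem_range.1 hi)]
    by_cases h : natBits k i ∈ E
    · rw [if_pos h, (Set.mem_iff_boolIndicator _ _).1 (show _ ∈ Ref from h)]; rfl
    · rw [if_neg h, (Set.notMem_iff_boolIndicator _ _).1 (show _ ∉ Ref from h)]; rfl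
  rw [h1, ← card_filter_ofFn_mem_eq_cnt]
  refine congrArg Finset.card (Finset.filter_congr fun s _ => ?_)
  rw [hC, ← Set.mem_iff_boolIndicator]
  have e : (List.ofFn fun i : Fin m => tableGenerator F f k nb s (Fin.castLE hm i)) =
      List.takeD m (F (boolPair (truthTable f) (boolPair (unaryEncodeNat nb) (List.ofFn s)))) false := by
    rw [← ofFn_getD_eq_takeD]
    simp [tableGenerator]
  rw [e]
  rfl

variable {Ref F}

/-- **The fooling step**: if every function of circuit complexity `> H` at scale `M` arms a
`SIZE(nb)`-pseudorandom generator, the table `T` (of `2^M` bits) is that hard, and Arthur's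
predicate at `(x, α, z)` is a circuit of size `≤ nb` on `nb` inputs reading `m ≤ nb` coins, then the
fraction of accepting seeds is within `1/nb` of Arthur's acceptance probability.
[cite: MurrayWilliams2018, Lemma 4.1 (proof)] -/
theorem abs_accCount_sub_le {M H nb m k : ℕ}
    (hfool : ∀ f : (Fin M → Bool) → Bool, H < circuitSizeOver B2 f →
      IsSizePseudorandom (tableGenerator F f k nb))
    (x α z T : List Bool) (hT : T.length = 2 ^ M)
    (hhard : ∀ f : (Fin M → Bool) → Bool, truthTable f = T → H < circuitSizeOver B2 f)
    (hm : m ≤ nb) (C : Circuit (Fin nb)) (hB : C.IsOver B2) (hs : C.size ≤ nb)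
    (hC : ∀ r, C.eval r = Ref.boolIndicator
      (boolPair (boolPair (boolPair x α) z) (List.ofFn fun i : Fin m => r (Fin.castLE hm i)))) :
    |(accCount Ref F x α z T k nb m : ℝ) / 2 ^ k -
        uniformProb m {r | boolPair (boolPair (boolPair x α) z) r ∈ Ref}| ≤ 1 / (nb : ℝ) := by
  have htf : T = truthTable (ofTruthTable T hT) := (truthTable_ofTruthTable T hT).symm
  have hcs : H < circuitSizeOver B2 (ofTruthTable T hT) := hhard _ htf.symm
  have hadv := hfool _ hcs C hB hs
  unfold prgAdvantage at hadv
  rw [card_seeds_eq_accCount Ref F x α z (ofTruthTable T hT) hm C hC,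
    PRGDerand.card_random_eq_uniformProb (L' := Ref) (boolPair (boolPair x α) z) hm C hC, ← htf] at hadv
  exact hadv

/-- **Soundness on a good input.** On the word `⟨x, ⟨x_h, α⟩⟩` — where every accepted witness of
`x_h` pads to a table of circuit complexity `> H`, hard functions at that scale arm
`SIZE(nb)`-pseudorandom generators, Arthur's predicates are circuits of size `≤ nb` (`nb ≥ 7`) — if
EVERY message of Merlin is accepted with probability `≤ 1/3`, then `N` rejects every guess.
[cite: MurrayWilliams2018, Lemma 4.1 (proof)] -/
theorem verdictBit_eq_false (x xh α : List Bool) {H : ℕ}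
    (hbad : ∀ y : List Bool, y.length ≤ bound t V xh.length → V.rel xh y = true →
      ∀ f : (Fin (scale t V xh.length) → Bool) → Bool,
        truthTable f = List.takeD (2 ^ scale t V xh.length) y false → H < circuitSizeOver B2 f)
    (hfool : ∀ f : (Fin (scale t V xh.length) → Bool) → Bool, H < circuitSizeOver B2 f →
      IsSizePseudorandom (tableGenerator F f (γ * scale t V xh.length) (Nb x.length α.length)))
    (hmnb : mv x.length ≤ Nb x.length α.length) (h7 : 7 ≤ Nb x.length α.length)
    (hC : ∀ z : List Bool, z.length = mv x.length →
      ∃ C : Circuit (Fin (Nb x.length α.length)), C.IsOver B2 ∧ C.size ≤ Nb x.length α.length ∧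
        ∀ r, C.eval r = Ref.boolIndicator (boolPair (boolPair (boolPair x α) z)
          (List.ofFn fun i : Fin (mv x.length) => r (Fin.castLE hmnb i))))
    (hrej : ∀ z : List Bool, z.length = mv x.length →
      uniformProb (mv x.length) {r | boolPair (boolPair (boolPair x α) z) r ∈ Ref} ≤ 1 / 3)
    (u : List Bool) :
    verdictBit t V Ref F γ mv Nb U (boolPair x (boolPair xh α)) u = false := by
  set w := boolPair x (boolPair xh α) with hw
  have hfst : fstF w = x := fstF_boolPair _ _
  have hxh : fstF (sndF w) = xh := by rw [hw, sndF_boolPair, fstF_boolPair]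
  have hα : sndF (sndF w) = α := by rw [hw, sndF_boolPair, sndF_boolPair]
  rw [verdictBit]
  simp only [hfst, hxh, hα]
  set y := witOf t V xh (fstF (u.take (U w.length))) with hy
  cases hrel : V.rel xh y with
  | false => rfl
  | true =>
    simp only [Bool.true_and, decide_eq_false_iff_not, not_lt]
    set z := List.takeD (mv x.length) (sndF (u.take (U w.length))) false with hz
    have hzlen : z.length = mv x.length := List.takeD_length _ _ _
    set T := tableOf t V xh (fstF (u.take (U w.length))) with hT
    have hTlen : T.length = 2 ^ scale t V xh.length := length_tableOf V _ _
    have hhard : ∀ f : (Fin (scale t V xh.length) → Bool) → Bool, truthTable f = T →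
        H < circuitSizeOver B2 f := fun f hf =>
      hbad y (length_witOf_le V _ _) hrel f (by rw [hf, hT]; rfl)
    obtain ⟨C, hB, hs, hCe⟩ := hC z hzlen
    have habs := abs_accCount_sub_le hfool x α z T hTlen hhard hmnb C hB hs hCe
    have hPr := hrej z hzlen
    have hlt : (accCount Ref F x α z T (γ * scale t V xh.length) (Nb x.length α.length)
        (mv x.length) : ℝ) / 2 ^ (γ * scale t V xh.length) < 1 / 2 :=
      lt_half_of_abs_sub_le habs hPr (one_div_lt_one_sixth h7)
    by_contra hle
    rw [not_le, two_pow_lt_two_mul_iff] at hle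
    linarith

/-- **Completeness on a good input.** Under the same hypotheses, if some message `z` of Merlin
(of the move length) is accepted with probability `≥ 2/3` and `y₀` is an accepted witness of `x_h`,
then the guess `⟨y₀, z⟩` — kept whole when `2|y₀| + |z| + 2 ≤ U|w|` — makes `N` accept.
[cite: MurrayWilliams2018, Lemma 4.1 (proof)] -/
theorem verdictBit_eq_true (x xh α : List Bool) {H : ℕ}
    (hbad : ∀ y : List Bool, y.length ≤ bound t V xh.length → V.rel xh y = true →
      ∀ f : (Fin (scale t V xh.length) → Bool) → Bool,
        truthTable f = List.takeD (2 ^ scale t V xh.length) y false → H < circuitSizeOver B2 f)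
    (hfool : ∀ f : (Fin (scale t V xh.length) → Bool) → Bool, H < circuitSizeOver B2 f →
      IsSizePseudorandom (tableGenerator F f (γ * scale t V xh.length) (Nb x.length α.length)))
    (hmnb : mv x.length ≤ Nb x.length α.length) (h7 : 7 ≤ Nb x.length α.length)
    (hC : ∀ z : List Bool, z.length = mv x.length →
      ∃ C : Circuit (Fin (Nb x.length α.length)), C.IsOver B2 ∧ C.size ≤ Nb x.length α.length ∧
        ∀ r, C.eval r = Ref.boolIndicator (boolPair (boolPair (boolPair x α) z)
          (List.ofFn fun i : Fin (mv x.length) => r (Fin.castLE hmnb i))))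
    {z : List Bool} (hzl : z.length = mv x.length)
    (hacc : 2 / 3 ≤ uniformProb (mv x.length) {r | boolPair (boolPair (boolPair x α) z) r ∈ Ref})
    {y₀ : List Bool} (hy₀ : y₀.length ≤ bound t V xh.length) (hrel : V.rel xh y₀ = true)
    (hU : 2 * y₀.length + mv x.length + 2 ≤ U (boolPair x (boolPair xh α)).length) :
    verdictBit t V Ref F γ mv Nb U (boolPair x (boolPair xh α)) (boolPair y₀ z) = true := by
  set w := boolPair x (boolPair xh α) with hw
  set u := boolPair y₀ z with hu
  have hfst : fstF w = x := fstF_boolPair _ _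
  have hxh : fstF (sndF w) = xh := by rw [hw, sndF_boolPair, fstF_boolPair]
  have hα : sndF (sndF w) = α := by rw [hw, sndF_boolPair, sndF_boolPair]
  -- the honest guess is kept whole
  have hulen : u.length ≤ U w.length := by
    simp only [hu, length_boolPair, hzl]
    omega
  have htake : u.take (U w.length) = u := List.take_of_length_le hulen
  have hwit : witOf t V xh (fstF u) = y₀ := by
    rw [hu, fstF_boolPair, witOf, List.take_of_length_le hy₀]
  have hmsg : List.takeD (mv x.length) (sndF u) false = z := by
    rw [hu, sndF_boolPair, List.takeD_eq_take _ hzl.ge, List.take_of_length_le hzl.le]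
  rw [verdictBit]
  simp only [hfst, hxh, hα, htake, hwit, hrel, hmsg, Bool.true_and, decide_eq_true_eq]
  set T := tableOf t V xh (fstF u) with hT
  have hTlen : T.length = 2 ^ scale t V xh.length := length_tableOf V _ _
  have hTy : T = List.takeD (2 ^ scale t V xh.length) y₀ false := by
    rw [hT, tableOf, hwit]
  have hhard : ∀ f : (Fin (scale t V xh.length) → Bool) → Bool, truthTable f = T →
      H < circuitSizeOver B2 f := fun f hf => hbad y₀ hy₀ hrel f (by rw [hf, hTy])
  obtain ⟨C, hB, hs, hCe⟩ := hC z hzl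
  have habs := abs_accCount_sub_le hfool x α z T hTlen hhard hmnb C hB hs hCe
  have hgt : (1 : ℝ) / 2 < (accCount Ref F x α z T (γ * scale t V xh.length)
      (Nb x.length α.length) (mv x.length) : ℝ) / 2 ^ (γ * scale t V xh.length) :=
    half_lt_of_abs_sub_le habs hacc (one_div_lt_one_sixth h7)
  rwa [two_pow_lt_two_mul_iff]

/-- **`N` decides the promise language on the good inputs.** On `w = ⟨x, ⟨x_h, α⟩⟩` with `x_h ∈ L`
bad at level `H` (every accepted witness pads to a hard table), hard functions arming the
generator, Arthur's predicates small circuits, and the kept length covering the honest guesses: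
if some message of Merlin (of the move length) is accepted with probability `≥ 2/3` then
`w ∈ simLang` (and `not_mem_simLang_of_rejected`: if every message is accepted with probability
`≤ 1/3` then `w ∉ simLang`). [cite: MurrayWilliams2018, Lemma 4.1 (proof)] -/
theorem mem_simLang_of_accepted (x xh α : List Bool) {H : ℕ} (hxh : xh ∈ L)
    (hbad : ∀ y : List Bool, y.length ≤ bound t V xh.length → V.rel xh y = true →
      ∀ f : (Fin (scale t V xh.length) → Bool) → Bool,
        truthTable f = List.takeD (2 ^ scale t V xh.length) y false → H < circuitSizeOver B2 f)
    (hfool : ∀ f : (Fin (scale t V xh.length) → Bool) → Bool, H < circuitSizeOver B2 f →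
      IsSizePseudorandom (tableGenerator F f (γ * scale t V xh.length) (Nb x.length α.length)))
    (hmnb : mv x.length ≤ Nb x.length α.length) (h7 : 7 ≤ Nb x.length α.length)
    (hC : ∀ z : List Bool, z.length = mv x.length →
      ∃ C : Circuit (Fin (Nb x.length α.length)), C.IsOver B2 ∧ C.size ≤ Nb x.length α.length ∧
        ∀ r, C.eval r = Ref.boolIndicator (boolPair (boolPair (boolPair x α) z)
          (List.ofFn fun i : Fin (mv x.length) => r (Fin.castLE hmnb i))))
    (hU : 2 * bound t V xh.length + mv x.length + 2 ≤ U (boolPair x (boolPair xh α)).length)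
    (hval : ∃ z : List Bool, z.length = mv x.length ∧
      (2 / 3 : ℝ) ≤ uniformProb (mv x.length) {r | boolPair (boolPair (boolPair x α) z) r ∈ Ref}) :
    boolPair x (boolPair xh α) ∈ simLang t V Ref F γ mv Nb U := by
  obtain ⟨z, hzl, hz⟩ := hval
  obtain ⟨y₀, hy₀, hrel⟩ := (V.mem_iff xh).1 hxh
  have hy₀' : y₀.length ≤ bound t V xh.length := hy₀
  have hU' : 2 * y₀.length + mv x.length + 2 ≤ U (boolPair x (boolPair xh α)).length :=
    le_trans (by omega) hU
  refine ⟨boolPair y₀ z, ?_, verdictBit_eq_true V γ mv Nb U x xh α hbad hfool hmnb h7 hC hzl hz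
    hy₀' hrel hU'⟩
  have h1 : (boolPair y₀ z).length = 2 * y₀.length + mv x.length + 2 := by
    simp only [length_boolPair, hzl]; ring
  rw [h1]
  exact hU'

/-- Soundness half of `N` deciding the promise language on the good inputs (every message accepted
with probability `≤ 1/3` ⟹ `w ∉ simLang`). [cite: MurrayWilliams2018, Lemma 4.1 (proof)] -/
theorem not_mem_simLang_of_rejected (x xh α : List Bool) {H : ℕ}
    (hbad : ∀ y : List Bool, y.length ≤ bound t V xh.length → V.rel xh y = true →
      ∀ f : (Fin (scale t V xh.length) → Bool) → Bool,
        truthTable f = List.takeD (2 ^ scale t V xh.length) y false → H < circuitSizeOver B2 f)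
    (hfool : ∀ f : (Fin (scale t V xh.length) → Bool) → Bool, H < circuitSizeOver B2 f →
      IsSizePseudorandom (tableGenerator F f (γ * scale t V xh.length) (Nb x.length α.length)))
    (hmnb : mv x.length ≤ Nb x.length α.length) (h7 : 7 ≤ Nb x.length α.length)
    (hC : ∀ z : List Bool, z.length = mv x.length →
      ∃ C : Circuit (Fin (Nb x.length α.length)), C.IsOver B2 ∧ C.size ≤ Nb x.length α.length ∧
        ∀ r, C.eval r = Ref.boolIndicator (boolPair (boolPair (boolPair x α) z)
          (List.ofFn fun i : Fin (mv x.length) => r (Fin.castLE hmnb i))))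
    (hval : ∀ z : List Bool, z.length = mv x.length →
      uniformProb (mv x.length) {r | boolPair (boolPair (boolPair x α) z) r ∈ Ref} ≤ 1 / 3) :
    boolPair x (boolPair xh α) ∉ simLang t V Ref F γ mv Nb U := by
  rintro ⟨u, -, hu⟩
  rw [verdictBit_eq_false V γ mv Nb U x xh α hbad hfool hmnb h7 hC hval u] at hu
  exact Bool.false_ne_true hu

/-- **From bad inputs in the prefix form to hard tables.** If no accepted witness of `x_h` (inside
the length bound) is a prefix of the truth table of a `B₂`-circuit with `≤ H` gates — the
`x_h`-instance of `¬ HasWitnessCircuits` — then every accepted witness pads (by `0`s, to `2^M`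
bits, `M` the table scale) to a table of circuit complexity `> H`: an optimal circuit for the
padded table (`exists_computes_B2_size_eq_holds`) would have the witness as a prefix of its truth
table. [cite: MurrayWilliams2018, Lemma 4.1 (proof)] -/
theorem hard_tables_of_bad (xh : List Bool) {H : ℕ}
    (hbad : ∀ (m : ℕ) (W : Circuit (Fin m)) (y : List Bool), W.IsOver B2 → W.size ≤ H →
      y.length ≤ bound t V xh.length → V.rel xh y = true → ¬ y <+: truthTable W.eval) :
    ∀ y : List Bool, y.length ≤ bound t V xh.length → V.rel xh y = true →
      ∀ f : (Fin (scale t V xh.length) → Bool) → Bool,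
        truthTable f = List.takeD (2 ^ scale t V xh.length) y false → H < circuitSizeOver B2 f := by
  intro y hy hrel f hf
  by_contra hle
  rw [not_lt] at hle
  obtain ⟨W, hB, hW, hsize⟩ := Literature.Computability.MetaComplexity.exists_computes_B2_size_eq_holds f
  refine hbad _ W y hB (hsize ▸ hle) hy hrel ?_
  have hfun : W.eval = f := funext hW
  rw [hfun, hf, takeD_of_length_le (hy.trans (bound_lt_two_pow_scale V _).le)]
  exact List.prefix_append _ _

end Correct

/-! ### Advice folding: hard-wiring the second component of a pair word -/

/-- The doubled bits of `boolPair`: position `j < 2|x|` of `⟨x, β⟩` reads `x[j/2]`. [folklore] -/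
theorem getElem_boolPair_left {x β : List Bool} {j : ℕ} (hj : j < 2 * x.length)
    (hj' : j < (boolPair x β).length) : (boolPair x β)[j] = x[j / 2]'(by omega) := by
  induction x generalizing j with
  | nil => simp at hj
  | cons b x ih =>
    rcases j with _ | _ | j
    · simp [boolPair]
    · simp [boolPair]
    · have h1 : j < 2 * x.length := by simp at hj; omega
      have h2 : j < (boolPair x β).length := by simp [length_boolPair] at hj' ⊢; omega
      have e : (boolPair (b :: x) β)[j + 2] = (boolPair x β)[j] := by
        simp [boolPair, List.flatMap_cons]
      rw [e, ih h1 h2]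
      have e2 : (j + 2) / 2 = j / 2 + 1 := by omega
      simp only [e2, List.getElem_cons_succ]

/-- The tail of `boolPair`: position `2|x| + i` of `⟨x, β⟩` reads `(0 :: 1 :: β)[i]`. [folklore] -/
theorem getElem_boolPair_right {x β : List Bool} {i : ℕ} (hi : i < β.length + 2)
    (hi' : 2 * x.length + i < (boolPair x β).length) :
    (boolPair x β)[2 * x.length + i] = (false :: true :: β)[i]'(by simp; omega) := by
  have hlen : (x.flatMap fun b => [b, b]).length = 2 * x.length := length_flatMap_dup x
  have e : boolPair x β = (x.flatMap fun b => [b, b]) ++ (false :: true :: β) := by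
    simp [boolPair]
  rw [List.getElem_of_eq e, List.getElem_append_right (by omega)]
  simp only [hlen, Nat.add_sub_cancel_left]

/-- **Advice folding.** For every language `L'` of pair words and every fixed second component
`β`, the language `{x : ⟨x, β⟩ ∈ L'}` has circuit complexity at length `ℓ` at most
`L'.circuitSize (2ℓ + |β| + 2) + 2`: take an optimal circuit for the slice of `L'` at the length
of `⟨x, β⟩`, identify the inputs `2i`, `2i+1` with `xᵢ` and hard-wire the separator and `β` (two
constant gates, `Circuit.exists_hardwire`). This is how a nondeterministic algorithm WITH ADVICE
inherits the assumed circuits of its advice-free pair language (Murray–Williams, p. 14: "`N`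
(using `(2d+1)n` bits of advice) … has circuits of size `s((2d+2)n)`").
[cite: MurrayWilliams2018, Lemma 4.1 (proof)] -/
theorem circuitSize_preimage_boolPair_le (L' : Language Bool) (β : List Bool) (ℓ : ℕ) :
    Language.circuitSize ((fun x => boolPair x β) ⁻¹' L') ℓ ≤
      L'.circuitSize (2 * ℓ + β.length + 2) + 2 := by
  have hN : (2 * ℓ + β.length + 2) = 2 * ℓ + (β.length + 2) := by ring
  obtain ⟨C, hCB, hCf, hCs⟩ := exists_circuit_size_eq_circuitSize L' (2 * ℓ + β.length + 2)
  let σ : Fin (2 * ℓ + β.length + 2) → Fin ℓ ⊕ Bool := fun j =>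
    if h : (j : ℕ) < 2 * ℓ then Sum.inl ⟨j / 2, by omega⟩
    else Sum.inr ((false :: true :: β)[(j : ℕ) - 2 * ℓ]'(by simp; omega))
  obtain ⟨D, hD, hsize, -, heval⟩ :=
    Circuit.exists_hardwire (show (0 : ℕ) ≤ 2 by omega) (show (0 : ℕ) ≤ 2 by omega) C hCB σ
  have hcomp : D.Computes (Language.sliceFn ((fun x => boolPair x β) ⁻¹' L') ℓ) := by
    intro x
    rw [heval, hCf]
    have hlist : List.ofFn (fun j => Sum.elim x id (σ j)) = boolPair (List.ofFn x) β := by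
      apply List.ext_getElem
      · simp only [List.length_ofFn, length_boolPair]; omega
      · intro i h₁ h₂
        rw [List.getElem_ofFn]
        by_cases hi : i < 2 * ℓ
        · have hσ : σ ⟨i, by rw [List.length_ofFn] at h₁; exact h₁⟩ = Sum.inl ⟨i / 2, by omega⟩ :=
            dif_pos hi
          rw [hσ, Sum.elim_inl, getElem_boolPair_left (by simpa using hi) h₂, List.getElem_ofFn]
        · have hi2 : i - 2 * ℓ < β.length + 2 := by rw [List.length_ofFn] at h₁; omega
          have hσ : σ ⟨i, by rw [List.length_ofFn] at h₁; exact h₁⟩ =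
              Sum.inr ((false :: true :: β)[i - 2 * ℓ]'(by simp; omega)) := dif_neg hi
          rw [hσ, Sum.elim_inr, id]
          have e : boolPair (List.ofFn x) β = boolPair (List.ofFn x) β := rfl
          have h3 : 2 * (List.ofFn x).length + (i - 2 * ℓ) < (boolPair (List.ofFn x) β).length := by
            simp only [List.length_ofFn, length_boolPair]; omega
          have h4 := getElem_boolPair_right (x := List.ofFn x) (β := β) hi2 h3
          have e2 : 2 * (List.ofFn x).length + (i - 2 * ℓ) = i := by simp; omega
          simp only [e2] at h4
          rw [h4]
    show L'.boolIndicator (List.ofFn fun j => Sum.elim x id (σ j)) =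
      Set.boolIndicator ((fun x => boolPair x β) ⁻¹' L') (List.ofFn x)
    rw [hlist]
    rfl
  calc Language.circuitSize ((fun x => boolPair x β) ⁻¹' L') ℓ ≤ D.size :=
        circuitSizeOver_le_of_computes D hD hcomp
    _ ≤ C.size + 2 := hsize
    _ = L'.circuitSize (2 * ℓ + β.length + 2) + 2 := by rw [hCs]

/-- **Slices of the simulation language give circuits for the promise language.** If on every word
`⟨x, β⟩` with `|x| = ℓ` membership in `L'` agrees with membership of `x` in `L₁`, then
`L₁.circuitSize ℓ ≤ L'.circuitSize (2ℓ + |β| + 2) + 2`. [cite: MurrayWilliams2018, Lemma 4.1 (proof)] -/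
theorem circuitSize_le_of_slice_agree {L₁ L' : Language Bool} (β : List Bool) (ℓ : ℕ)
    (h : ∀ x : List Bool, x.length = ℓ → (x ∈ L₁ ↔ boolPair x β ∈ L')) :
    L₁.circuitSize ℓ ≤ L'.circuitSize (2 * ℓ + β.length + 2) + 2 := by
  have e : L₁.circuitSize ℓ = Language.circuitSize ((fun x => boolPair x β) ⁻¹' L') ℓ :=
    AlmostAE.circuitSize_eq_of_forall_iff fun y hy => by rw [h y hy]; rfl
  rw [e]
  exact circuitSize_preimage_boolPair_le L' β ℓ

end MWSim

end Literature.Computability.Complexity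

end
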